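import Summits.AtomisticToContinuum.HydrodynamicLimit.Theorems.JParityClosureParityBandClosureEnergyFloorPathwise
import Summits.AtomisticToContinuum.HydrodynamicLimit.Theorems.InformationPercolationEngineChaosClosesEulerReductionCoincidence
import Summits.AtomisticToContinuum.HydrodynamicLimit.Theorems.JParityClosureParityInBandDensity
import Summits.AtomisticToContinuum.HydrodynamicLimit.Theorems.JParityClosureParityInBandEnergyTight
import Literature.MathematicalPhysics.KineticTheory.HardSphereTwoTimePressure
import Summits.AtomisticToContinuum.HydrodynamicLimit.Theorems.JParityClosureParityBandClosureCoarseEntropy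
import HarnessLib

/-!
# Line `entropy-floor-fixes-energy` (crux `JParityClosure.ParityBandClosure`, stmt-AtomisticToContinuum-17608),
# stub `stub_energyFloorOfEntropyFloor` — part 4: THE STUB (probabilistic assembly)

`CoarseEntropyIntegrable → EntropyNoDipAt → JParityClosure.DensityCap → MomentumConjunct → EnergyFloorConjunct`
(skeleton v2/v3 of `Cruxes/ParityBandClosure/Lines/entropy_floor_fixes_energy.lean`; the waypoints `EntropyNoDipAt`,
`MomentumConjunct`, `EnergyFloorConjunct` are written out VERBATIM in the header — the registered signature of the stub is
this expanded text — `CoarseEntropyIntegrable` is the landed worker def, the crux `DensityCap` is used by name). At a fixed `t ∈ [0,T)`, for a nonnegative continuous `χ` and `δ > 0`,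
the lower energy deviation event `{⟨E_N(t), χ⟩ < ∫χẼ(t) − δ}` is covered by eight bad events — the flow's bad set and the
velocity-coincidence event (NULL: `ChaosClosesEulerReduction.measure_coincSet_eq_zero`,
`localGibbsLaw_absolutelyContinuous`), the kinetic-energy tail (`exists_energy_tail_le`), the entropy DIP
(`EntropyNoDipAt` at tolerance `δ/8`), the density OVERSHOOT (`DensityCap`, sup form — puts `ρ_rσ³` in the analytic band
and feeds the cold-cell threshold), the `L¹` density error (`densityCap_mollDensity_L1_at`), and the three momentum
deviations (`MomentumConjunct` tested with `χũ_k`) — because off all of them the deterministic chain of parts 1–3 (`pathwise_energy_floor`) gives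
`⟨E_N(t), χ⟩ ≥ ∫χ e_r − δ/8 ≥ ∫χẼ − δ/8 − δ/8 − δ/4 − δ/8 > ∫χẼ − δ` (`integrated_energy_floor` + the floor + the `L¹`
cap + the componentwise momentum comparison through the cone commutator + the energy commutator). Thresholds:
`η₀ := min η₀ᶠˡᵒᵒʳ (min η₀ᵐᵒᵐ (η_E/4))`, `σ₀ := min`'s cut at `1/2`; order of choices: tolerances, then `r`, then `N`.
No named fact is invoked (the equation of state enters through the PROVED `HsEosLowDensity`, `eos_band`).
-/

noncomputable section

namespace Summit.AtomisticToContinuum.HydrodynamicLimit.Theorems.ParityBandClosureEnergyFloor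

open scoped BigOperators Topology Classical MeasureTheory ENNReal InnerProductSpace
open Filter Set MeasureTheory
open Literature.MathematicalPhysics.KineticTheory
open Literature.Analysis.FluidPDE
open Literature.Analysis.FunctionSpaces
open Summit.AtomisticToContinuum.HydrodynamicLimit.Theses
open Summit.AtomisticToContinuum.HydrodynamicLimit.Theorems.DensityCapNegative
  (cone cone_nonneg cone_le mollDensity_eq mollDensity_nonneg capEvent CapLimit densityCap_iff)
open Summit.AtomisticToContinuum.HydrodynamicLimit.Theorems.KineticClosureDensity
  (continuous_mollDensity exists_modulus_euclidDist)
open Summit.AtomisticToContinuum.HydrodynamicLimit.Theorems.KineticClosureBridge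
  (continuous_mollMomentum continuous_mollEnergy norm_empiricalMomentumField_sub_integral_smul_le
    abs_empiricalEnergyField_sub_integral_mul_le meanSpeed_le meanEnergy_eq exists_energy_tail_le)
open Summit.AtomisticToContinuum.HydrodynamicLimit.Theorems.ChaosClosesEulerReduction
  (measure_coincSet_eq_zero vel_ne_of_not_mem_coincSet)
open Summit.AtomisticToContinuum.HydrodynamicLimit.Theorems.ParityBandClosureCoarseEntropy (CoarseEntropyIntegrable)

/-! ## The stub -/

/-- **STUB `stub_energyFloorOfEntropyFloor`** (line `entropy-floor-fixes-energy`, crux `ParityBandClosure`,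
stmt-AtomisticToContinuum-17608; skeleton v2): integrability of the coarse-grained entropy + the fixed-time entropy floor
+ the density cap + the momentum third at the instant ⇒ no local energy deficit at the instant. See the module
docstring for the covering by eight bad events and the deterministic chain. [folklore] -/
theorem stub_energyFloorOfEntropyFloor : CoarseEntropyIntegrable →
  (∃ η₀ : ℝ, 0 < η₀ ∧ ∀ (a₀ θ₀ : T3 → ℝ) (u₀ : T3 → V3), Continuous a₀ → Continuous θ₀ → Continuous u₀ →
    (∀ x, 0 < a₀ x) → (∀ x, 0 < θ₀ x) → ∃ σ₀ : ℝ, 0 < σ₀ ∧ ∀ σ : ℝ, 0 < σ → σ < σ₀ →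
    ∀ (T : ℝ) (ρ θ : ℝ → T3 → ℝ) (u : ℝ → T3 → V3), IsHardSphereEulerSolution σ T ρ u θ →
    (∀ t ∈ Set.Ico 0 T, ∀ x, ρ t x * σ ^ 3 < η₀) →
    ∀ Φ : (N : ℕ) → HardSphereFlow (Torus.geometry (Fin 3)) (hsDiameter σ N) (N + 1),
    TendstoHydroFieldsAt (fun N => localGibbsLaw σ a₀ u₀ θ₀ N (Φ N)) Φ ρ u θ 0 →
    ∀ t ∈ Set.Ico 0 T, ∀ ψ : T3 → ℝ, Continuous ψ → (∀ x, 0 ≤ ψ x) → ∀ η δ : ℝ, 0 < η → 0 < δ →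
    ∃ r₀ : ℝ, 0 < r₀ ∧ ∀ r : ℝ, 0 < r → r < r₀ → ∃ N₀ : ℕ, ∀ N : ℕ, N₀ ≤ N →
    let bx : T3 → T3 → ℝ := fun x y => 3 / (Real.pi * r ^ 3) * max (1 - Torus.euclidDist x y / r) 0
    let ρm : Config (N + 1) (Fin 3) T3 → T3 → ℝ := fun w x₀ => ∫ q, bx q.1 x₀ ∂(empiricalMeasure w)
    let mm : Config (N + 1) (Fin 3) T3 → T3 → V3 := fun w x₀ => ∫ q, bx q.1 x₀ • q.2 ∂(empiricalMeasure w)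
    let em : Config (N + 1) (Fin 3) T3 → T3 → ℝ := fun w x₀ =>
      ∫ q, bx q.1 x₀ * (‖q.2‖ ^ 2 / 2) ∂(empiricalMeasure w)
    let θm : Config (N + 1) (Fin 3) T3 → T3 → ℝ := fun w x₀ =>
      2 / 3 * (em w x₀ / ρm w x₀ - ‖mm w x₀‖ ^ 2 / (2 * ρm w x₀ ^ 2))
    let Hs : ℝ → ℝ → ℝ := fun a b =>
      if 0 < a ∧ 0 < b then -(a * (3 / 2 * Real.log b - Real.log a - hsExcessFreeEnergy (a * σ ^ 3))) else 0
    localGibbsLaw σ a₀ u₀ θ₀ N (Φ N)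
      {z | (∫ x : T3, ψ x * θ t x *
          (Hs (ρ t x) (θ t x) - Hs (ρm ((Φ N).flow t z) x) (θm ((Φ N).flow t z) x))) < -η} ≤ ENNReal.ofReal δ) →
    JParityClosure.DensityCap →
  (∃ η₀ : ℝ, 0 < η₀ ∧ ∀ (a₀ θ₀ : T3 → ℝ) (u₀ : T3 → V3), Continuous a₀ → Continuous θ₀ → Continuous u₀ →
    (∀ x, 0 < a₀ x) → (∀ x, 0 < θ₀ x) → ∃ σ₀ : ℝ, 0 < σ₀ ∧ ∀ σ : ℝ, 0 < σ → σ < σ₀ →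
    ∀ (T : ℝ) (ρ θ : ℝ → T3 → ℝ) (u : ℝ → T3 → V3), IsHardSphereEulerSolution σ T ρ u θ →
    (∀ t ∈ Set.Ico 0 T, ∀ x, ρ t x * σ ^ 3 < η₀) →
    ∀ Φ : (N : ℕ) → HardSphereFlow (Torus.geometry (Fin 3)) (hsDiameter σ N) (N + 1),
    TendstoHydroFieldsAt (fun N => localGibbsLaw σ a₀ u₀ θ₀ N (Φ N)) Φ ρ u θ 0 →
    ∀ t ∈ Set.Ico 0 T, ∀ χ : T3 → ℝ, Continuous χ → ∀ δ > (0 : ℝ),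
      Tendsto (fun N => localGibbsLaw σ a₀ u₀ θ₀ N (Φ N)
        {z | δ < ‖empiricalMomentumField ((Φ N).flow t z) χ - ∫ x, (χ x * ρ t x) • u t x‖}) atTop (𝓝 0)) →
  (∃ η₀ : ℝ, 0 < η₀ ∧ ∀ (a₀ θ₀ : T3 → ℝ) (u₀ : T3 → V3), Continuous a₀ → Continuous θ₀ → Continuous u₀ →
    (∀ x, 0 < a₀ x) → (∀ x, 0 < θ₀ x) → ∃ σ₀ : ℝ, 0 < σ₀ ∧ ∀ σ : ℝ, 0 < σ → σ < σ₀ →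
    ∀ (T : ℝ) (ρ θ : ℝ → T3 → ℝ) (u : ℝ → T3 → V3), IsHardSphereEulerSolution σ T ρ u θ →
    (∀ t ∈ Set.Ico 0 T, ∀ x, ρ t x * σ ^ 3 < η₀) →
    ∀ Φ : (N : ℕ) → HardSphereFlow (Torus.geometry (Fin 3)) (hsDiameter σ N) (N + 1),
    TendstoHydroFieldsAt (fun N => localGibbsLaw σ a₀ u₀ θ₀ N (Φ N)) Φ ρ u θ 0 →
    ∀ t ∈ Set.Ico 0 T, ∀ χ : T3 → ℝ, Continuous χ → (∀ x, 0 ≤ χ x) → ∀ δ : ℝ, 0 < δ →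
      Tendsto (fun N => localGibbsLaw σ a₀ u₀ θ₀ N (Φ N)
        {z | empiricalEnergyField ((Φ N).flow t z) χ <
          (∫ x, χ x * totalEnergyDensity (ρ t x) (u t x) (θ t x)) - δ}) atTop (𝓝 0)) := by
  intro hCEI hFloor hD hMom
  unfold CoarseEntropyIntegrable at hCEI
  obtain ⟨η₀F, hη₀F, HF⟩ := hFloor
  obtain ⟨η₀M, hη₀M, HM⟩ := hMom
  obtain ⟨ηE, hηE, hfc, B, hB0, hB, L, hL0, hL⟩ := eos_band
  set η₀ : ℝ := min η₀F (min η₀M (ηE / 4)) with hη₀def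
  have hη₀ : 0 < η₀ := lt_min hη₀F (lt_min hη₀M (by positivity))
  refine ⟨η₀, hη₀, fun a₀ θ₀ u₀ ha hθ hu ha0 hθ0 => ?_⟩
  obtain ⟨σF, hσF, HF1⟩ := HF a₀ θ₀ u₀ ha hθ hu ha0 hθ0
  obtain ⟨σM, hσM, HM1⟩ := HM a₀ θ₀ u₀ ha hθ hu ha0 hθ0
  obtain ⟨σD, hσD, HD1⟩ := (densityCap_iff.1 hD) a₀ θ₀ u₀ ha hθ hu ha0 hθ0
  obtain ⟨σL, hσL, HL1⟩ := ParityInBandDensity.densityCap_mollDensity_L1_at hD a₀ θ₀ u₀ ha hθ hu ha0 hθ0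
  refine ⟨min (min σF σM) (min (min σD σL) (1 / 2)), by positivity,
    fun σ hσ hσlt T ρ θ u hE hguard Φ h0 t ht χ hχ hχ0 δ hδ => ?_⟩
  -- §0 thresholds
  have hσF' : σ < σF := hσlt.trans_le ((min_le_left _ _).trans (min_le_left _ _))
  have hσM' : σ < σM := hσlt.trans_le ((min_le_left _ _).trans (min_le_right _ _))
  have hσD' : σ < σD := hσlt.trans_le ((min_le_right _ _).trans ((min_le_left _ _).trans (min_le_left _ _)))
  have hσL' : σ < σL := hσlt.trans_le ((min_le_right _ _).trans ((min_le_left _ _).trans (min_le_right _ _)))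
  have hσ2 : σ ≤ 1 / 2 := (hσlt.trans_le ((min_le_right _ _).trans (min_le_right _ _))).le
  have hσ3 : σ ^ 3 ≤ 1 := pow_le_one₀ hσ.le (by linarith)
  have hη₀F' : η₀ ≤ η₀F := min_le_left _ _
  have hη₀M' : η₀ ≤ η₀M := (min_le_right _ _).trans (min_le_left _ _)
  have hη₀E' : η₀ ≤ ηE / 4 := (min_le_right _ _).trans (min_le_right _ _)
  have hguardF : ∀ s ∈ Set.Ico 0 T, ∀ x, ρ s x * σ ^ 3 < η₀F := fun s hs x => (hguard s hs x).trans_le hη₀F'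
  have hguardM : ∀ s ∈ Set.Ico 0 T, ∀ x, ρ s x * σ ^ 3 < η₀M := fun s hs x => (hguard s hs x).trans_le hη₀M'
  -- the inputs at this `σ`, solution, flow family, tie and instant
  have HF2 := HF1 σ hσ hσF' T ρ θ u hE hguardF Φ h0 t ht χ hχ hχ0
  have HM2 := HM1 σ hσ hσM' T ρ θ u hE hguardM Φ h0 t ht
  have HD2 : CapLimit σ a₀ u₀ θ₀ Φ ρ t := HD1 σ hσ hσD' T ρ θ u hE Φ h0 t ht
  have HL2 := HL1 σ hσ hσL' T ρ θ u hE Φ h0 t ht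
  -- the time-`t` slices of the classical solution
  have hρt : Continuous (ρ t) := (hE.smooth_density.isSmooth_slice ht).continuous
  have hut : Continuous (u t) := (hE.smooth_velocity.isSmooth_slice ht).continuous
  have hθt : Continuous (θ t) := (hE.smooth_temperature.isSmooth_slice ht).continuous
  have hρpos : ∀ x, 0 < ρ t x := hE.density_pos t ht
  have hθpos : ∀ x, 0 < θ t x := hE.temperature_pos t ht
  have hρtb : ∀ x, ρ t x * σ ^ 3 ≤ ηE / 2 := fun x => by linarith [hguard t ht x, hη₀E']
  rw [ENNReal.tendsto_atTop_zero]
  intro ε hε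
  obtain ⟨δ'', hδ'', hδ''ε⟩ := exists_pos_ofReal_le hε
  set δ' : ℝ := δ'' / 8 with hδ'def
  have hδ' : 0 < δ' := by positivity
  -- §1 constants at time `t`
  obtain ⟨θmin, hθmin, hθmin_le⟩ : ∃ m : ℝ, 0 < m ∧ ∀ x, m ≤ θ t x := by
    obtain ⟨x₀, -, hx₀⟩ := isCompact_univ.exists_isMinOn Set.univ_nonempty hθt.continuousOn
    exact ⟨θ t x₀, hθpos x₀, fun x => hx₀ (Set.mem_univ x)⟩
  obtain ⟨KE, hKE0, HKE⟩ := exists_energy_tail_le (u₀ := u₀) ha hθ hu ha0 hθ0 hσ2 hδ'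
  have hKc : Continuous fun x => χ x * (θ t x * (3 / 2 * |Real.log (θ t x)| + |Real.log (ρ t x)| + 1 + B +
      ρ t x * σ ^ 3 * L) + 3 / 2 * θ t x + ‖u t x‖ ^ 2 / 2) := by
    have hlθ : Continuous fun x => Real.log (θ t x) := hθt.log fun x => (hθpos x).ne'
    have hlρ : Continuous fun x => Real.log (ρ t x) := hρt.log fun x => (hρpos x).ne'
    exact hχ.mul (((hθt.mul ((((((continuous_const.mul hlθ.abs).add hlρ.abs).add continuous_const).add
      continuous_const).add ((hρt.mul continuous_const).mul continuous_const)))).add (continuous_const.mul hθt)).add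
      ((hut.norm.pow 2).div_const 2))
  obtain ⟨K₀, hK₀0, hK₀⟩ := exists_forall_abs_le_of_continuous hKc
  obtain ⟨Cχ, hCχ0, hCχ⟩ := exists_forall_abs_le_of_continuous hχ
  obtain ⟨Cu, hCu0, hCu⟩ := exists_forall_abs_le_of_continuous hut.norm
  have hCu' : ∀ x, ‖u t x‖ ≤ Cu := fun x => (le_abs_self _).trans (hCu x)
  -- §2 tolerances (all independent of `r` and `N`)
  set η₁ : ℝ := δ / 8 with hη₁def
  set η₂ : ℝ := δ / (8 * (K₀ + 1)) with hη₂def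
  set ηcap : ℝ := ηE / 4 with hηcapdef
  set δm : ℝ := δ / 24 with hδmdef
  set κE : ℝ := δ / (8 * (KE + 1)) with hκEdef
  set κm : ℝ := δ / (24 * (KE + 1)) with hκmdef
  set κχ : ℝ := κm / (2 * (Cu + 1)) with hκχdef
  set κu : ℝ := κm / (2 * (Cχ + 1)) with hκudef
  have hη₁ : 0 < η₁ := by positivity
  have hη₂ : 0 < η₂ := by positivity
  have hηcap : 0 < ηcap := by positivity
  have hδm : 0 < δm := by positivity
  have hκE : 0 < κE := by positivity
  have hκm : 0 < κm := by positivity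
  -- §3 the radii and the scale
  obtain ⟨r₀F, hr₀F, HF3⟩ := HF2 η₁ δ' hη₁ hδ'
  obtain ⟨r₀D, hr₀D, HD3⟩ := HD2 ηcap δ' hηcap hδ'
  obtain ⟨r₀L, hr₀L, HL3⟩ := HL2 η₂ δ' hη₂ hδ'
  obtain ⟨r₁, hr₁, hmodE⟩ := exists_modulus_euclidDist hχ hκE
  obtain ⟨r₂, hr₂, hmodχ⟩ := exists_modulus_euclidDist hχ (show 0 < κχ by positivity)
  obtain ⟨r₃, hr₃, hmodu⟩ := exists_modulus_euclidDist_V3 hut (show 0 < κu by positivity)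
  obtain ⟨r, hr, hrF, hrD, hrL, hrr₁, hrr₂, hrr₃, hrhalf⟩ := stub_energyFloorScale hr₀F hr₀D hr₀L hr₁ hr₂ hr₃
  obtain ⟨N₀F, HF4⟩ := HF3 r hr hrF
  obtain ⟨N₀D, HD4⟩ := HD3 r hr hrD
  obtain ⟨N₀L, HL4⟩ := HL3 r hr hrL
  -- §4 the momentum tests `χ ũ_k`
  have hχk : ∀ k : Fin 3, Continuous fun x => χ x * u t x k := fun k =>
    hχ.mul ((EuclideanSpace.proj (𝕜 := ℝ) k).continuous.comp hut)
  have HM3 : ∀ k : Fin 3, ∃ N₀ : ℕ, ∀ N, N₀ ≤ N → localGibbsLaw σ a₀ u₀ θ₀ N (Φ N)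
      {z | δm < ‖empiricalMomentumField ((Φ N).flow t z) (fun x => χ x * u t x k) -
        ∫ x, ((χ x * u t x k) * ρ t x) • u t x‖} ≤ ENNReal.ofReal δ' := fun k =>
    ENNReal.tendsto_atTop_zero.1 (HM2 _ (hχk k) δm hδm) _ (ENNReal.ofReal_pos.2 hδ')
  choose Nm hNm using HM3
  -- §5 the cold-cell threshold
  set ρstar : ℝ := Real.exp (3 / 2 * Real.log θmin - 3 / 2 - B) with hρstardef
  have hρstar : 0 < ρstar := Real.exp_pos _
  obtain ⟨N₁, hN₁⟩ := exists_nat_gt (3 / (Real.pi * r ^ 3 * ρstar))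
  -- §6 `N₀`
  refine ⟨max (max (max N₀F N₀D) (max N₀L N₁)) (max (Nm 0) (max (Nm 1) (Nm 2))), fun N hN => ?_⟩
  have hNa : max (max N₀F N₀D) (max N₀L N₁) ≤ N := (le_max_left _ _).trans hN
  have hNb : max (Nm 0) (max (Nm 1) (Nm 2)) ≤ N := (le_max_right _ _).trans hN
  have hNF : N₀F ≤ N := ((le_max_left _ _).trans (le_max_left _ _)).trans hNa
  have hND : N₀D ≤ N := ((le_max_right _ _).trans (le_max_left _ _)).trans hNa
  have hNL : N₀L ≤ N := ((le_max_left _ _).trans (le_max_right _ _)).trans hNa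
  have hN1 : N₁ ≤ N := ((le_max_right _ _).trans (le_max_right _ _)).trans hNa
  have hNm' : ∀ k : Fin 3, Nm k ≤ N := by
    intro k
    fin_cases k
    · exact (le_max_left _ _).trans hNb
    · exact ((le_max_left _ _).trans (le_max_right _ _)).trans hNb
    · exact ((le_max_right _ _).trans (le_max_right _ _)).trans hNb
  -- §7 this `N`: the law, the null events, the bad events
  set P := localGibbsLaw σ a₀ u₀ θ₀ N (Φ N) with hPdef
  have hgood : P (Φ N).goodᶜ = 0 := localGibbsLaw_compl_good σ a₀ θ₀ u₀ N (Φ N)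
  set C : Set (Config (N + 1) (Fin 3) T3) := ⋃ q : ℚ, ⋃ i : Fin (N + 1), ⋃ j : Fin (N + 1),
    {z | i ≠ j ∧ ((Φ N).flow q z i).2 = ((Φ N).flow q z j).2} with hCdef
  have hC : P C = 0 := measure_coincSet_eq_zero (Φ N) (localGibbsLaw_absolutelyContinuous σ a₀ u₀ θ₀ N (Φ N))
  set BE : Set (Config (N + 1) (Fin 3) T3) := {z | KE < ((N : ℝ) + 1)⁻¹ * configEnergy ((Φ N).flow t z)} with hBEdef
  set BF : Set (Config (N + 1) (Fin 3) T3) := {z | (∫ x : T3, χ x * θ t x *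
      (LocalSecondLawNegative.Hs σ (ρ t x) (θ t x) -
        LocalSecondLawNegative.Hs σ (DensityCapNegative.mollDensity r ((Φ N).flow t z) x)
          (2 / 3 * (empiricalEnergyField ((Φ N).flow t z) (fun y => cone r y x) / DensityCapNegative.mollDensity r ((Φ N).flow t z) x -
            ‖empiricalMomentumField ((Φ N).flow t z) (fun y => cone r y x)‖ ^ 2 /
              (2 * DensityCapNegative.mollDensity r ((Φ N).flow t z) x ^ 2))))) < -η₁} with hBFdef
  set BD : Set (Config (N + 1) (Fin 3) T3) := capEvent Φ N ρ t ηcap r with hBDdef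
  set BL : Set (Config (N + 1) (Fin 3) T3) := {z | η₂ < ∫ x, |DensityCapNegative.mollDensity r ((Φ N).flow t z) x - ρ t x|} with hBLdef
  set BM : Fin 3 → Set (Config (N + 1) (Fin 3) T3) := fun k =>
    {z | δm < ‖empiricalMomentumField ((Φ N).flow t z) (fun x => χ x * u t x k) -
      ∫ x, ((χ x * u t x k) * ρ t x) • u t x‖} with hBMdef
  have hPE : P BE ≤ ENNReal.ofReal δ' := HKE N (Φ N) t
  have hPF : P BF ≤ ENNReal.ofReal δ' := HF4 N hNF
  have hPD : P BD ≤ ENNReal.ofReal δ' := HD4 N hND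
  have hPL : P BL ≤ ENNReal.ofReal δ' := HL4 N hNL
  have hPM : ∀ k, P (BM k) ≤ ENNReal.ofReal δ' := fun k => hNm k N (hNm' k)
  -- §8 the deterministic chain off the bad events
  have key : ∀ z, z ∈ (Φ N).good → z ∉ C → z ∉ BE → z ∉ BF → z ∉ BD → z ∉ BL → (∀ k, z ∉ BM k) →
      (∫ x, χ x * totalEnergyDensity (ρ t x) (u t x) (θ t x)) - δ ≤ empiricalEnergyField ((Φ N).flow t z) χ := by
    intro z hz hzC hzE hzF hzD hzL hzM
    -- read the facts off the complements (type ascriptions unfold the events)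
    have hvel : ∀ i j : Fin (N + 1), i ≠ j → ((Φ N).flow t z i).2 ≠ ((Φ N).flow t z j).2 :=
      vel_ne_of_not_mem_coincSet (Φ N) hz hzC t
    have hzE' : ¬ KE < ((N : ℝ) + 1)⁻¹ * configEnergy ((Φ N).flow t z) := hzE
    have hEn : ((N : ℝ) + 1)⁻¹ * configEnergy ((Φ N).flow t z) ≤ KE := not_lt.1 hzE'
    have hzD' : ¬ ∃ s ∈ Set.Icc 0 t, ∃ x : T3, ρ s x + ηcap < DensityCapNegative.mollDensity r ((Φ N).flow s z) x := hzD
    have hcapx : ∀ x, DensityCapNegative.mollDensity r ((Φ N).flow t z) x ≤ ρ t x + ηE / 4 := by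
      intro x
      by_contra hcx
      exact hzD' ⟨t, ⟨ht.1, le_rfl⟩, x, not_le.1 hcx⟩
    have hzF' : ¬ (∫ x : T3, χ x * θ t x * (LocalSecondLawNegative.Hs σ (ρ t x) (θ t x) -
        LocalSecondLawNegative.Hs σ (DensityCapNegative.mollDensity r ((Φ N).flow t z) x)
          (2 / 3 * (empiricalEnergyField ((Φ N).flow t z) (fun y => cone r y x) /
              DensityCapNegative.mollDensity r ((Φ N).flow t z) x -
            ‖empiricalMomentumField ((Φ N).flow t z) (fun y => cone r y x)‖ ^ 2 /
              (2 * DensityCapNegative.mollDensity r ((Φ N).flow t z) x ^ 2))))) < -η₁ := hzF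
    have hzL' : ¬ η₂ < ∫ x, |DensityCapNegative.mollDensity r ((Φ N).flow t z) x - ρ t x| := hzL
    have hzM' : ∀ k : Fin 3, ¬ δm < ‖empiricalMomentumField ((Φ N).flow t z) (fun x => χ x * u t x k) -
        ∫ x, ((χ x * u t x k) * ρ t x) • u t x‖ := fun k => hzM k
    -- integrability of the coarse-grained entropy: the registered stub `stub_coarseEntropyIntegrable`
    have hint : (∀ x, DensityCapNegative.mollDensity r ((Φ N).flow t z) x * σ ^ 3 ≤ ηE / 2) →
        Integrable (fun x : T3 => LocalSecondLawNegative.Hs σ (DensityCapNegative.mollDensity r ((Φ N).flow t z) x)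
          (2 / 3 * (empiricalEnergyField ((Φ N).flow t z) (fun y => cone r y x) /
              DensityCapNegative.mollDensity r ((Φ N).flow t z) x -
            ‖empiricalMomentumField ((Φ N).flow t z) (fun y => cone r y x)‖ ^ 2 /
              (2 * DensityCapNegative.mollDensity r ((Φ N).flow t z) x ^ 2)))) := fun hb =>
      hCEI σ r (ηE / 2) hσ hr hrhalf hfc N ((Φ N).flow t z) hvel hb
    -- the cold-cell threshold for this `N ≥ N₁`
    have hnR : (0 : ℝ) < ((N + 1 : ℕ) : ℝ) := by positivity
    have hρstarN : ((N + 1 : ℕ) : ℝ)⁻¹ * (3 / (Real.pi * r ^ 3)) ≤ ρstar := by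
      have hN1' : 3 / (Real.pi * r ^ 3 * ρstar) < ((N + 1 : ℕ) : ℝ) := by
        have : (N₁ : ℝ) ≤ N := by exact_mod_cast hN1
        push_cast
        linarith
      rw [div_lt_iff₀ (by positivity)] at hN1'
      rw [inv_mul_le_iff₀ hnR, div_le_iff₀ (by positivity)]
      linarith
    -- the arithmetic of the tolerances
    have hden' : K₀ * η₂ ≤ δ / 8 := by
      rw [hη₂def, show K₀ * (δ / (8 * (K₀ + 1))) = δ / 8 * (K₀ / (K₀ + 1)) by field_simp]
      exact mul_le_of_le_one_right (by positivity) ((div_le_one (by positivity)).2 (by linarith))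
    have hκE' : κE * KE ≤ δ / 8 := by
      rw [hκEdef, show δ / (8 * (KE + 1)) * KE = δ / 8 * (KE / (KE + 1)) by field_simp]
      exact mul_le_of_le_one_right (by positivity) ((div_le_one (by positivity)).2 (by linarith))
    have hκm' : 3 * (κm * (1 / 2 + KE) + δm) ≤ δ / 4 := by
      have h1 : κm * (1 / 2 + KE) ≤ δ / 24 := by
        rw [hκmdef, show δ / (24 * (KE + 1)) * (1 / 2 + KE) = δ / 24 * ((1 / 2 + KE) / (KE + 1)) by field_simp]
        exact mul_le_of_le_one_right (by positivity) ((div_le_one (by positivity)).2 (by linarith))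
      rw [hδmdef]
      linarith
    have hκχ' : κχ * Cu ≤ κm / 2 := by
      rw [hκχdef, show κm / (2 * (Cu + 1)) * Cu = κm / 2 * (Cu / (Cu + 1)) by field_simp]
      exact mul_le_of_le_one_right (by positivity) ((div_le_one (by positivity)).2 (by linarith))
    have hκu' : Cχ * κu ≤ κm / 2 := by
      rw [hκudef, show Cχ * (κm / (2 * (Cχ + 1))) = κm / 2 * (Cχ / (Cχ + 1)) by field_simp]
      exact mul_le_of_le_one_right (by positivity) ((div_le_one (by positivity)).2 (by linarith))
    exact pathwise_energy_floor ((Φ N).flow t z) hσ hσ3 hr hrhalf hηE hχ hρt hθt hut hχ0 hρpos hθpos hfc hB hL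
      hθmin hθmin_le (fun x => by linarith [hguard t ht x, hη₀E']) hvel hEn hcapx hρstarN hint hK₀0
      (fun x => (le_abs_self _).trans (hK₀ x)) (not_lt.1 hzF') (not_lt.1 hzL')
      (fun x y hxy => hmodE x y (hxy.trans_le hrr₁)) (fun x y hxy => hmodχ x y (hxy.trans_le hrr₂))
      (fun x y hxy => hmodu x y (hxy.trans_le hrr₃)) hCχ0 hCχ hCu' (fun k => not_lt.1 (hzM' k)) hκE.le hκm.le
      le_rfl hden' hκE' hκm' hκχ' hκu'
  -- §9 the union bound
  have hsub : {z : Config (N + 1) (Fin 3) T3 | empiricalEnergyField ((Φ N).flow t z) χ <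
      (∫ x, χ x * totalEnergyDensity (ρ t x) (u t x) (θ t x)) - δ} ⊆
      (((Φ N).goodᶜ ∪ C) ∪ (BE ∪ BF)) ∪ ((BD ∪ BL) ∪ (BM 0 ∪ (BM 1 ∪ BM 2))) := by
    intro z hz
    by_contra hzc
    simp only [Set.mem_union, not_or, Set.mem_compl_iff, not_not] at hzc
    obtain ⟨⟨⟨hz1, hz2⟩, hz3, hz4⟩, ⟨hz5, hz6⟩, hz7, hz8, hz9⟩ := hzc
    have hk : ∀ k, z ∉ BM k := by
      intro k
      fin_cases k
      · exact hz7
      · exact hz8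
      · exact hz9
    have h := key z hz1 hz2 hz3 hz4 hz5 hz6 hk
    exact (not_lt.2 h) hz
  calc P {z | empiricalEnergyField ((Φ N).flow t z) χ < (∫ x, χ x * totalEnergyDensity (ρ t x) (u t x) (θ t x)) - δ}
      ≤ P ((((Φ N).goodᶜ ∪ C) ∪ (BE ∪ BF)) ∪ ((BD ∪ BL) ∪ (BM 0 ∪ (BM 1 ∪ BM 2)))) := measure_mono hsub
    _ ≤ ((P (Φ N).goodᶜ + P C) + (P BE + P BF)) + ((P BD + P BL) + (P (BM 0) + (P (BM 1) + P (BM 2)))) := by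
        refine (measure_union_le _ _).trans (add_le_add ?_ ?_)
        · exact (measure_union_le _ _).trans (add_le_add (measure_union_le _ _) (measure_union_le _ _))
        · refine (measure_union_le _ _).trans (add_le_add (measure_union_le _ _) ?_)
          exact (measure_union_le _ _).trans (add_le_add le_rfl (measure_union_le _ _))
    _ ≤ ((0 + 0) + (ENNReal.ofReal δ' + ENNReal.ofReal δ')) +
          ((ENNReal.ofReal δ' + ENNReal.ofReal δ') + (ENNReal.ofReal δ' + (ENNReal.ofReal δ' + ENNReal.ofReal δ'))) := by
        gcongr
        · exact hgood.le
        · exact hC.le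
        · exact hPM 0
        · exact hPM 1
        · exact hPM 2
    _ = 7 * ENNReal.ofReal δ' := by ring
    _ = ENNReal.ofReal (7 * δ') := by rw [ENNReal.ofReal_mul (by norm_num), ENNReal.ofReal_ofNat]
    _ ≤ ENNReal.ofReal δ'' := ENNReal.ofReal_le_ofReal (by rw [hδ'def]; linarith)
    _ ≤ ε := hδ''ε

end Summit.AtomisticToContinuum.HydrodynamicLimit.Theorems.ParityBandClosureEnergyFloor

end
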